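import Summits.QuantumFields.YangMills.Theorems.BalabanUVNodesN15BumpTwoGridFit
import Summits.QuantumFields.YangMills.Theorems.BalabanUVNodesN15PartitionKingTorus
import HarnessLib

/-!
# THE SMOOTH CUT-OFF WITH A PLATEAU, IV: the sampled bump ON KING'S TORUS PAIR `blockOf L N : Tor (fine L N) → Tor N` (`N_ν = K·m`, coordinates `x_ν.val∕m` and
# `x′_ν.val∕(Lm)`, shifts `· + e_μ`) — EVERY bump letter of files 44∕45 with explicit constants: `c_t = |n|π∕m`, value fit `π·d·(L − 1)∕(Lm)`, difference-quotient fit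
# `(|n|∕m)(1∕m)(32π⁴ + π²d)`, the plateau identity at `R ≥ 1 + 1∕m`, and a nested-bump input cut at `R′ ≥ R + 1 + 1∕m` (non-vacuity of the bump family on the carrier of
# record's model pair) (dag-n15-w4 g3, width seat on N15 = NE2; dag-n15-w3 g4's located item (r2))

Cell `pub-ymgap`, seat `pub-ymgap-dag-n15-w4` (director №399 (3a) width; HUMAN RULING D-0062), generation 3.  `bears_on: R4∕N15 · K3⁸ SpineGivenEndpointR13SepCoPHV
(stmt-QuantumFields-27366)`.  Filed `--supports stmt-QuantumFields-27366 --as helper` — COUNT-NEUTRAL.  Theorems only (0 `def`, 0 `sorry`; coordinates inline as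
`fun ν x => ((x ν).val : ℝ) ∕ m`).  Imports BY NAME this seat's FILE III `…N15BumpTwoGridFit` (`abs_fgrad_bcube_two_grid_le`, `abs_bgrad_bcube_two_grid_le`; through it FILE II
`bcube`, `abs_fgrad_bcube_le`, `abs_bgrad_bcube_le`, `abs_bcube_sub_bcube_le`, `mulOp_hcube_comp_lapOp_mulOp_comp_one_sub_bcube`, `bcube_wider_eq_one_of_near_box`) and dag-n15-w4 g0's
`…N15PartitionKingTorus` (`kingTorus_hξ`, `kingTorus_hξ_fine`, `kingTorus_hoff`; through it `…N15KingTorusLine` `unitVec`, the tree's `B5Prop11Plancherel.Tor`∕`fine`,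
`King1986.Torus.blockOf`∕`blockEquiv`∕`site`).  Nothing in the tree is modified.

WHY.  FILES I–III state the bump's letters on any carrier under FILE 61's coordinate hypotheses `hξ`, `hξ′`, `hoff`; dag-n15-w4 g0's `…N15PartitionKingTorus` DISCHARGED those
hypotheses on King's torus pair.  THIS FILE applies the former at the latter, so that the bump family `hχt hdχt hdχtb hfitχ hfit₂ hfit₂b hL` of files 44∕45 (and the admissibility
of an input cut for `hsub … hddb2`) is exhibited on a concrete two-grid carrier with every constant written out: §1 one grid — ★ `abs_fgrad_bcube_kingTorus_le` ∕ `abs_bgrad_bcube_kingTorus_le`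
(`c_t = |n|π∕m`), ★★ `mulOp_hcube_comp_lapOp_mulOp_comp_one_sub_bcube_kingTorus` (`hL` with a multiplication-operator potential, `R ≥ 1 + 1∕m`), ★ `bcube_wider_eq_one_of_near_box_kingTorus`
(the cut hypothesis of FILE II §3 holds for `χ := χ̃^{R′}_k`, `R′ ≥ R + 1 + 1∕m`); §2 two grids — ★ `abs_bcube_sub_bcube_kingTorus_le` (`hfitχ`: `≤ π·d·(L − 1)∕(Lm)`), ★★
`abs_fgrad_bcube_two_grid_kingTorus_le` ∕ `abs_bgrad_bcube_two_grid_kingTorus_le` (`hfit₂`∕`hfit₂b`: `≤ (|n|∕m)(1∕m)(32π⁴ + π²d)`, `R ≥ 0`, `K ≥ 2R + 4`); §3 (v1.1, append-only) ★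
`abs_bcube_shift_sub_bcube_shift_kingTorus_le` ∕ `abs_bcube_shift_symm_sub_bcube_shift_symm_kingTorus_le` (`hfit₁`∕`hfit₁b`: `≤ π·d∕m`, `≤ 2π·d∕m`).

HONEST FRAMING ∕ LIMITS.  One-line instances; an A6-style NON-VACUITY certificate for the bump side of the dressed gluing only — the operator side (cube entries, cut rows, `V̂`,
blocks `S_k`) stays the consumers'; [B6] (2.36) p.229 and [B9] (3.62)–(3.65) pp.402–403 = SHAPES, nothing of [B5]∕[B6]∕[B9] asserted.  NE2⁺ NOT PRINTED, NOT proved; N15 NOT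
discharged; counts of record UNMOVED (typed 28∕28 · discharged 5∕27); one finite 𝕋⁴ at fixed ε — NOT infinite volume, NOT OS on ℝ⁴, NOT a mass gap, NOT Clay; R4 closes the
conditional finite-𝕋⁴ rung `BalabanLadder.UV` only.  Restate-immune (no Theses import).
-/

noncomputable section

namespace Summit.QuantumFields.YangMills.BalabanUVNodes.N15.Gluing

open Real
open Literature.MathematicalPhysics.QuantumFieldTheory.Balaban1983to89.B5Prop11Plancherel (Tor fine)
open Literature.MathematicalPhysics.QuantumFieldTheory.Balaban1983to89.B6Prop26Gluing (mulOp)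
open Literature.MathematicalPhysics.QuantumFieldTheory.King1986.Torus (site blockEquiv blockEquiv_apply blockOf blockOf_site val_site)
open Summit.QuantumFields.YangMills.BalabanUVNodes.N15.KingTorusLine (unitVec)
open Summit.QuantumFields.YangMills.BalabanUVNodes.N15.BackgroundLayer (fgrad bgrad)

/-! ## §1 One grid: the difference-quotient letter, the plateau identity, an admissible input cut -/

section Coarse

variable {d : ℕ} {N : Fin d → ℕ} [hNz : ∀ μ, NeZero (N μ)] {K m : ℕ} (R : ℝ)

/-- ★ **`hdχt` ON KING'S TORUS**: `|∇_μ χ̃_k| ≤ |n|·π∕m` (FILE II `abs_fgrad_bcube_le`, `hξ` = dag-n15-w4 g0 `kingTorus_hξ`). [cite: Balaban1985BackgroundPropagators, (3.62)–(3.65) pp.402–403 (shape)] -/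
theorem abs_fgrad_bcube_kingTorus_le (hN : ∀ μ, N μ = K * m) (hK : 0 < K) (hm : 0 < m) (n : ℝ) (k : Fin d → ZMod K) (μ : Fin d) (x : Tor N) :
    |fgrad n (Equiv.addRight (unitVec N μ)) (bcube K (fun ν (x : Tor N) => (((x ν).val : ℕ) : ℝ) / m) R k) x| ≤ |n| * (π * (1 / m)) := by
  have hmr : (0 : ℝ) < m := by exact_mod_cast hm
  have h := abs_fgrad_bcube_le K (fun ν (x : Tor N) => (((x ν).val : ℕ) : ℝ) / m) R (fun μ => Equiv.addRight (unitVec N μ)) hK (kingTorus_hξ hN hm) n k μ x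
  rwa [abs_of_pos (by positivity : (0 : ℝ) < 1 / m)] at h

/-- ★ **`hdχtb` ON KING'S TORUS**: `|∇⁻_μ χ̃_k| ≤ |n|·π∕m` (FILE II `abs_bgrad_bcube_le`). [cite: Balaban1985BackgroundPropagators, (3.62)–(3.65) pp.402–403 (shape)] -/
theorem abs_bgrad_bcube_kingTorus_le (hN : ∀ μ, N μ = K * m) (hK : 0 < K) (hm : 0 < m) (n : ℝ) (k : Fin d → ZMod K) (μ : Fin d) (x : Tor N) :
    |bgrad n (Equiv.addRight (unitVec N μ)) (bcube K (fun ν (x : Tor N) => (((x ν).val : ℕ) : ℝ) / m) R k) x| ≤ |n| * (π * (1 / m)) := by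
  have hmr : (0 : ℝ) < m := by exact_mod_cast hm
  have h := abs_bgrad_bcube_le K (fun ν (x : Tor N) => (((x ν).val : ℕ) : ℝ) / m) R (fun μ => Equiv.addRight (unitVec N μ)) hK (kingTorus_hξ hN hm) n k μ x
  rwa [abs_of_pos (by positivity : (0 : ℝ) < 1 / m)] at h

/-- ★★ **THE PLATEAU IDENTITY `hL` ON KING'S TORUS** (potential part a multiplication operator): `R ≥ 1 + 1∕m` ⟹ `M_{h_k}∘(Σ_μ∇*_μ∇_μ + M_w)∘M_{1−χ̃_k} = 0`
(FILE II `mulOp_hcube_comp_lapOp_mulOp_comp_one_sub_bcube` at `s = 1∕m`). [cite: Balaban1984PropagatorsII, (2.91) p.239 (mechanism); Balaban1985BackgroundPropagators, (3.26) p.395 (shape)] -/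
theorem mulOp_hcube_comp_lapOp_mulOp_comp_one_sub_bcube_kingTorus (hN : ∀ μ, N μ = K * m) (hK : 0 < K) (hm : 0 < m) (hR : 1 + 1 / (m : ℝ) ≤ R) (n : ℝ) (w : Tor N → ℝ)
    (k : Fin d → ZMod K) :
    mulOp (hcube K (fun ν (x : Tor N) => (((x ν).val : ℕ) : ℝ) / m) k) ∘ₗ lapOp n (fun μ => Equiv.addRight (unitVec N μ)) (mulOp w) ∘ₗ
      mulOp (1 - bcube K (fun ν (x : Tor N) => (((x ν).val : ℕ) : ℝ) / m) R k) = 0 := by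
  have hmr : (0 : ℝ) < m := by exact_mod_cast hm
  exact mulOp_hcube_comp_lapOp_mulOp_comp_one_sub_bcube K (fun ν (x : Tor N) => (((x ν).val : ℕ) : ℝ) / m) R (fun μ => Equiv.addRight (unitVec N μ)) hK (kingTorus_hξ hN hm)
    (by rwa [abs_of_pos (by positivity : (0 : ℝ) < 1 / m)]) n w k

/-- ★ **AN ADMISSIBLE INPUT CUT ON KING'S TORUS**: for `R′ ≥ R + 1 + 1∕m` the wider bump `χ̃^{R′}_k` is `1` wherever FILE II §3's cut hypothesis asks (so `hsub … hddb2` hold with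
`χ := χ̃^{R′}_k`; FILE II `bcube_wider_eq_one_of_near_box`). [cite: Balaban1985BackgroundPropagators, (3.62)–(3.65) pp.402–403 (nested cut-offs: shape)] -/
theorem bcube_wider_eq_one_of_near_box_kingTorus (hN : ∀ μ, N μ = K * m) (hK : 0 < K) (hm : 0 < m) {R' : ℝ} (hR' : R + 1 + 1 / (m : ℝ) ≤ R') (k : Fin d → ZMod K) (μ : Fin d)
    (x : Tor N) (hx : ∃ x₀ : Tor N, (x₀ = x ∨ x₀ = Equiv.addRight (unitVec N μ) x ∨ x₀ = (Equiv.addRight (unitVec N μ)).symm x) ∧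
      ∀ ν, |cenRep K ((((x₀ ν).val : ℕ) : ℝ) / m - ((k ν).val : ℝ))| < R + 1) :
    bcube K (fun ν (x : Tor N) => (((x ν).val : ℕ) : ℝ) / m) R' k x = 1 := by
  have hmr : (0 : ℝ) < m := by exact_mod_cast hm
  exact bcube_wider_eq_one_of_near_box K (fun ν (x : Tor N) => (((x ν).val : ℕ) : ℝ) / m) R (fun μ => Equiv.addRight (unitVec N μ)) hK (kingTorus_hξ hN hm)
    (by rwa [abs_of_pos (by positivity : (0 : ℝ) < 1 / m)]) k μ x hx

end Coarse

/-! ## §2 Two spacings: the value fit and the difference-quotient fits across `blockOf` -/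

section TwoGrid

variable {d : ℕ} {L : ℕ} [NeZero L] {N : Fin d → ℕ} [hNz : ∀ μ, NeZero (N μ)] {K m : ℕ} (R : ℝ)

/-- ★ **THE VALUE FIT `hfitχ` ON KING'S TORUS PAIR**: `|χ̃′_k(x′) − χ̃_k(blockOf x′)| ≤ π·d·(L − 1)∕(Lm)` (FILE II `abs_bcube_sub_bcube_le`, in-block offsets `j_ν ≤ L − 1`).
[cite: Balaban1985BackgroundPropagators, Thm 3.14 pp.426–427 (difference template: shape)] -/
theorem abs_bcube_sub_bcube_kingTorus_le (hK : 0 < K) (hm : 0 < m) (k : Fin d → ZMod K) (x' : Tor (fine L N)) :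
    |bcube K (fun ν (x' : Tor (fine L N)) => (((x' ν).val : ℕ) : ℝ) / ((L : ℝ) * m)) R k x' - bcube K (fun ν (x : Tor N) => (((x ν).val : ℕ) : ℝ) / m) R k (blockOf L N x')|
      ≤ π * d * (((L : ℝ) - 1) / ((L : ℝ) * m)) := by
  have hL : 0 < L := Nat.pos_of_ne_zero (NeZero.ne L)
  have hLr : (0 : ℝ) < L := by exact_mod_cast hL
  have hmr : (0 : ℝ) < m := by exact_mod_cast hm
  refine (abs_bcube_sub_bcube_le K _ R _ hK k x' (blockOf L N x')).trans ?_
  rw [mul_assoc]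
  refine mul_le_mul_of_nonneg_left ?_ Real.pi_pos.le
  obtain ⟨⟨b, j⟩, rfl⟩ := (blockEquiv L N).surjective x'
  have hterm : ∀ ν : Fin d, |cenRep K ((((site L N b j ν).val : ℕ) : ℝ) / ((L : ℝ) * m) - ((((blockOf L N (site L N b j)) ν).val : ℕ) : ℝ) / m)| ≤ ((L : ℝ) - 1) / ((L : ℝ) * m) := by
    intro ν
    rw [blockOf_site, val_site]
    have e : (((L * (b ν).val + (j ν : ℕ) : ℕ) : ℝ)) / ((L : ℝ) * m) - (((b ν).val : ℕ) : ℝ) / m = ((j ν : ℕ) : ℝ) / ((L : ℝ) * m) := by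
      push_cast; field_simp; ring
    rw [e]
    refine (abs_cenRep_le_abs_sub hK _ 0).trans ?_
    rw [Int.cast_zero, zero_mul, sub_zero, abs_of_nonneg (by positivity)]
    refine div_le_div_of_nonneg_right ?_ (by positivity)
    have : (j ν : ℕ) + 1 ≤ L := (j ν).isLt
    have : ((j ν : ℕ) : ℝ) + 1 ≤ L := by exact_mod_cast this
    linarith
  calc ∑ ν : Fin d, |cenRep K ((((blockEquiv L N (b, j)) ν).val : ℝ) / ((L : ℝ) * m) - ((((blockOf L N (blockEquiv L N (b, j))) ν).val : ℕ) : ℝ) / m)|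
      ≤ ∑ ν : Fin d, ((L : ℝ) - 1) / ((L : ℝ) * m) := Finset.sum_le_sum fun ν _ => by rw [blockEquiv_apply]; exact hterm ν
    _ = d * (((L : ℝ) - 1) / ((L : ℝ) * m)) := by rw [Finset.sum_const, Finset.card_univ, Fintype.card_fin, nsmul_eq_mul]

/-- ★★ **THE DIFFERENCE-QUOTIENT FIT `hfit₂` ON KING'S TORUS PAIR** (FILE III `abs_fgrad_bcube_two_grid_le` with `s = 1∕m`, `s′ = 1∕(Lm)`, `n′ = L·n`, `κ = n∕m`; `R ≥ 0`,
`K ≥ 2R + 4`, `m ≥ 1`): `|∇′_μ χ̃′_k(x′) − ∇_μ χ̃_k(blockOf x′)| ≤ (|n|∕m)·(1∕m)·(32π⁴ + π²d)`. [cite: Balaban1985BackgroundPropagators, (3.62)–(3.65) pp.402–403 (shape), Thm 3.14 pp.426–427 (difference template)] -/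
theorem abs_fgrad_bcube_two_grid_kingTorus_le (hN : ∀ μ, N μ = K * m) (hR : 0 ≤ R) (hRK : 2 * R + 4 ≤ K) (hm : 0 < m) (n : ℝ) (k : Fin d → ZMod K) (μ : Fin d) (x' : Tor (fine L N)) :
    |fgrad (L * n) (Equiv.addRight (unitVec (fine L N) μ)) (bcube K (fun ν (x' : Tor (fine L N)) => (((x' ν).val : ℕ) : ℝ) / ((L : ℝ) * m)) R k) x'
      - fgrad n (Equiv.addRight (unitVec N μ)) (bcube K (fun ν (x : Tor N) => (((x ν).val : ℕ) : ℝ) / m) R k) (blockOf L N x')|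
      ≤ |n| / m * (1 / m) * (32 * π ^ 4 + π ^ 2 * d) := by
  have hL : 0 < L := Nat.pos_of_ne_zero (NeZero.ne L)
  have hL1 : 1 ≤ L := hL
  have hLr : (0 : ℝ) < L := by exact_mod_cast hL
  have hmr : (0 : ℝ) < m := by exact_mod_cast hm
  have hm1 : (1 : ℝ) ≤ m := by exact_mod_cast hm
  have hL1r : (1 : ℝ) ≤ L := by exact_mod_cast hL1
  have hK0 : 0 < K := Nat.cast_pos.1 ((show (0 : ℝ) < 2 * R + 4 by linarith).trans_le hRK)
  have h := abs_fgrad_bcube_two_grid_le K (fun ν (x : Tor N) => (((x ν).val : ℕ) : ℝ) / m) (fun ν (x' : Tor (fine L N)) => (((x' ν).val : ℕ) : ℝ) / ((L : ℝ) * m)) R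
    (blockOf L N) (fun μ => Equiv.addRight (unitVec N μ)) (fun μ => Equiv.addRight (unitVec (fine L N) μ)) hK0 hR hRK (s := 1 / m) (s' := 1 / ((L : ℝ) * m)) (κ := n / m) (n := n)
    (n' := L * n) hL1 (by positivity) (by rw [div_le_one (by positivity)]; nlinarith [hL1r, hm1]) (by field_simp) (by field_simp) (by field_simp)
    (kingTorus_hξ hN hm) (kingTorus_hξ_fine L hN hm) (kingTorus_hoff L K hm) k μ x'
  rw [abs_div, Nat.abs_cast, Fintype.card_fin] at h
  exact h

/-- ★★ **THE BACKWARD DIFFERENCE-QUOTIENT FIT `hfit₂b` ON KING'S TORUS PAIR** (FILE III `abs_bgrad_bcube_two_grid_le`): `|∇′⁻_μ χ̃′_k(x′) − ∇⁻_μ χ̃_k(blockOf x′)| ≤ (|n|∕m)·(1∕m)·(32π⁴ + π²d)`.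
[cite: Balaban1985BackgroundPropagators, (3.62)–(3.65) pp.402–403 (shape), Thm 3.14 pp.426–427 (difference template)] -/
theorem abs_bgrad_bcube_two_grid_kingTorus_le (hN : ∀ μ, N μ = K * m) (hR : 0 ≤ R) (hRK : 2 * R + 4 ≤ K) (hm : 0 < m) (n : ℝ) (k : Fin d → ZMod K) (μ : Fin d) (x' : Tor (fine L N)) :
    |bgrad (L * n) (Equiv.addRight (unitVec (fine L N) μ)) (bcube K (fun ν (x' : Tor (fine L N)) => (((x' ν).val : ℕ) : ℝ) / ((L : ℝ) * m)) R k) x'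
      - bgrad n (Equiv.addRight (unitVec N μ)) (bcube K (fun ν (x : Tor N) => (((x ν).val : ℕ) : ℝ) / m) R k) (blockOf L N x')|
      ≤ |n| / m * (1 / m) * (32 * π ^ 4 + π ^ 2 * d) := by
  have hL : 0 < L := Nat.pos_of_ne_zero (NeZero.ne L)
  have hL1 : 1 ≤ L := hL
  have hLr : (0 : ℝ) < L := by exact_mod_cast hL
  have hmr : (0 : ℝ) < m := by exact_mod_cast hm
  have hm1 : (1 : ℝ) ≤ m := by exact_mod_cast hm
  have hL1r : (1 : ℝ) ≤ L := by exact_mod_cast hL1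
  have hK0 : 0 < K := Nat.cast_pos.1 ((show (0 : ℝ) < 2 * R + 4 by linarith).trans_le hRK)
  have h := abs_bgrad_bcube_two_grid_le K (fun ν (x : Tor N) => (((x ν).val : ℕ) : ℝ) / m) (fun ν (x' : Tor (fine L N)) => (((x' ν).val : ℕ) : ℝ) / ((L : ℝ) * m)) R
    (blockOf L N) (fun μ => Equiv.addRight (unitVec N μ)) (fun μ => Equiv.addRight (unitVec (fine L N) μ)) hK0 hR hRK (s := 1 / m) (s' := 1 / ((L : ℝ) * m)) (κ := n / m) (n := n)
    (n' := L * n) hL1 (by positivity) (by rw [div_le_one (by positivity)]; nlinarith [hL1r, hm1]) (by field_simp) (by field_simp) (by field_simp)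
    (kingTorus_hξ hN hm) (kingTorus_hξ_fine L hN hm) (kingTorus_hoff L K hm) k μ x'
  rw [abs_div, Nat.abs_cast, Fintype.card_fin] at h
  exact h

end TwoGrid

/-! ## §3 (v1.1) The shifted value fits `hfit₁`∕`hfit₁b` on King's torus pair -/

section ShiftFit

variable {d : ℕ} {L : ℕ} [NeZero L] {N : Fin d → ℕ} [hNz : ∀ μ, NeZero (N μ)] {K m : ℕ} (R : ℝ)

/-- ★ **`hfit₁` ON KING'S TORUS PAIR**: `|χ̃′_k(x′ + e′_μ) − χ̃_k(blockOf x′ + e_μ)| ≤ π·d∕m` (FILE III v1.1 `abs_bcube_shift_sub_bcube_shift_le` at `s = 1∕m`, `s′ = 1∕(Lm)`).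
[cite: Balaban1985BackgroundPropagators, (3.62)–(3.65) pp.402–403 (shape), Thm 3.14 pp.426–427 (difference template)] -/
theorem abs_bcube_shift_sub_bcube_shift_kingTorus_le (hN : ∀ μ, N μ = K * m) (hK : 0 < K) (hm : 0 < m) (k : Fin d → ZMod K) (μ : Fin d) (x' : Tor (fine L N)) :
    |bcube K (fun ν (x' : Tor (fine L N)) => (((x' ν).val : ℕ) : ℝ) / ((L : ℝ) * m)) R k (Equiv.addRight (unitVec (fine L N) μ) x')
      - bcube K (fun ν (x : Tor N) => (((x ν).val : ℕ) : ℝ) / m) R k (Equiv.addRight (unitVec N μ) (blockOf L N x'))| ≤ π * (d * (1 / (m : ℝ))) := by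
  have hL : 0 < L := Nat.pos_of_ne_zero (NeZero.ne L)
  have hL1 : 1 ≤ L := hL
  have hLr : (0 : ℝ) < L := by exact_mod_cast hL
  have hmr : (0 : ℝ) < m := by exact_mod_cast hm
  have h := abs_bcube_shift_sub_bcube_shift_le K (fun ν (x : Tor N) => (((x ν).val : ℕ) : ℝ) / m) (fun ν (x' : Tor (fine L N)) => (((x' ν).val : ℕ) : ℝ) / ((L : ℝ) * m)) R
    (blockOf L N) (fun μ => Equiv.addRight (unitVec N μ)) (fun μ => Equiv.addRight (unitVec (fine L N) μ)) hK (s := 1 / m) (s' := 1 / ((L : ℝ) * m)) hL1 (by positivity)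
    (by field_simp) (kingTorus_hξ hN hm) (kingTorus_hξ_fine L hN hm) (kingTorus_hoff L K hm) k μ x'
  rw [Fintype.card_fin] at h
  exact h

/-- ★ **`hfit₁b` ON KING'S TORUS PAIR**: `|χ̃′_k(x′ − e′_μ) − χ̃_k(blockOf x′ − e_μ)| ≤ 2π·d∕m` (FILE III v1.1 `abs_bcube_shift_symm_sub_bcube_shift_symm_le`).
[cite: Balaban1985BackgroundPropagators, (3.62)–(3.65) pp.402–403 (shape), Thm 3.14 pp.426–427 (difference template)] -/
theorem abs_bcube_shift_symm_sub_bcube_shift_symm_kingTorus_le (hN : ∀ μ, N μ = K * m) (hK : 0 < K) (hm : 0 < m) (k : Fin d → ZMod K) (μ : Fin d) (x' : Tor (fine L N)) :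
    |bcube K (fun ν (x' : Tor (fine L N)) => (((x' ν).val : ℕ) : ℝ) / ((L : ℝ) * m)) R k ((Equiv.addRight (unitVec (fine L N) μ)).symm x')
      - bcube K (fun ν (x : Tor N) => (((x ν).val : ℕ) : ℝ) / m) R k ((Equiv.addRight (unitVec N μ)).symm (blockOf L N x'))| ≤ π * (d * (2 * (1 / (m : ℝ)))) := by
  have hL : 0 < L := Nat.pos_of_ne_zero (NeZero.ne L)
  have hL1 : 1 ≤ L := hL
  have hLr : (0 : ℝ) < L := by exact_mod_cast hL
  have hmr : (0 : ℝ) < m := by exact_mod_cast hm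
  have h := abs_bcube_shift_symm_sub_bcube_shift_symm_le K (fun ν (x : Tor N) => (((x ν).val : ℕ) : ℝ) / m) (fun ν (x' : Tor (fine L N)) => (((x' ν).val : ℕ) : ℝ) / ((L : ℝ) * m)) R
    (blockOf L N) (fun μ => Equiv.addRight (unitVec N μ)) (fun μ => Equiv.addRight (unitVec (fine L N) μ)) hK (s := 1 / m) (s' := 1 / ((L : ℝ) * m)) hL1 (by positivity)
    (by field_simp) (kingTorus_hξ hN hm) (kingTorus_hξ_fine L hN hm) (kingTorus_hoff L K hm) k μ x'
  rw [Fintype.card_fin] at h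
  exact h

end ShiftFit

end Summit.QuantumFields.YangMills.BalabanUVNodes.N15.Gluing

end
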